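import Mathlib.Topology.Instances.ENNReal.Lemmas
import Mathlib.Topology.Order.LocalExtr
import Literature.Geometry.Lorentzian.Hypersurface
import Literature.Geometry.Lorentzian.IsometryProofs
import Literature.Geometry.Lorentzian.LeviCivita
import HarnessLib

/-!
# The level set flow of a closed set and the arrival time of a mean-convex domain
# (White 2000; Hershkovits–White 2020, App. Def. 19; Colding–Minicozzi 2016)

Topic `Literature/Geometry/Riemannian` (family SPC4; definition request `MeanConvexLevelSetFlow`
of route `SmoothPoincare4/MinimalSphereMeanConvex`, engine `HorizonFreeSideTwoHandlebody`, for its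
layer-2 children `ExtinctionLemma` / `ArrivalTimeTwoHandlebody`).

## The printed definitions

* **Weak set flow** (Hershkovits–White, CPAM 73 (2020), Appendix, Def. 19 — the definition used in
  White, JAMS 13 (2000), §2, and White, JAMS 16 (2003); held text `paper:arxiv-1704.00431`, p. 11):
  "Let `W` be an open subset of a Riemannian manifold and `I ⊆ ℝ` be an interval. A family
  `t ∈ I ↦ M(t)` of subsets of `W` is called a weak set flow in `W` provided:
  • `{(x,t) : t ∈ I, x ∈ M(t)}` is a relatively closed subset of `W × I`.
  • If `[a,b] ⊆ I`, if `t ∈ [a,b] ↦ S(t) ⊆ W` is a classical mean curvature flow of smooth, closed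
  hypersurfaces, and if `S(a)` is disjoint from `M(a)`, then `S(t)` is disjoint from `M(t)` for all
  `t ∈ [a,b]`."
* **Level set flow** (ibid., after Thm. 20; and p. 3): "Given a relatively closed set `M` of `W`,
  there is a (unique) weak set flow `t ∈ [0,∞) ↦ F_t(M)` in `W` for which `F_0(M) = M` and for
  which the following property holds: if `t ∈ [0,T] ↦ S(t)` is any weak set flow in `W` with
  `S(0) ⊆ M`, then `S(t) ⊆ F_t(M)` for all `t ∈ [0,T]`. The flow `t ∈ [0,∞) ↦ F_t(M)` is the level
  set flow starting at `M`." — "the level set flow is fully characterized as the maximal family of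
  sets satisfying the two properties above [Ilmanen; White 1995]" (p. 3); it agrees with the
  Evans–Spruck / Chen–Giga–Goto viscosity level-set flow.
* **Arrival time** (Colding–Minicozzi, CPAM 69 (2016), §1, held text `paper:arxiv-1501.07899`,
  p. 3): for the flow `M_t` of a closed smooth mean convex hypersurface `M₀` bounding the compact
  domain `Ω₀`, "`M_t` … moves monotonically inward as it sweeps out `Ω₀`" (footnote: "Each `M_t`
  bounds a compact domain `Ω_t` and `Ω_t = ∪_{s ≥ t} M_s`"), "The arrival time `u : Ω₀ → ℝ` is the
  time when the front `M_t` arrives at a point `x ∈ Ω₀`, `u(x) = {t | x ∈ M_t}`" — "equivalent to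
  the level set method" (`v(x,t) = u(x) − t`, Evans–Spruck), `u` being the unique viscosity
  solution of `Δu − Hess_u(∇u/|∇u|, ∇u/|∇u|) = −1` (§1.1, §4), i.e. `|∇u| div(∇u/|∇u|) = −1`,
  with `u = 0` on `∂Ω₀`. For a compact mean-convex `K` White (2000, Thm. 3.1) shows
  `F_t(K) ⊆ F_s(K)` for `s ≤ t`, so `F_t(K) = {u ≥ t}` with `u(x) = sup {t : x ∈ F_t(K)}`.

## Lean rendering (all REAL definitions; no facts)

Ambient: a manifold `M` modelled on `EuclideanSpace ℝ (Fin (n+1))` with a metric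
`g : PseudoRiemannianMetric (𝓡 (n+1)) ∞ _ (TangentSpace (𝓡 (n+1)))` carrying its Levi-Civita
connection (`[g.HasLeviCivita]`; `g.IsRiemannian` is a hypothesis of theorems, not of the
definitions), exactly the currency of the engine item `HorizonFreeSideTwoHandlebody` (`n = 3`).

* `IsClassicalMCF g F ν a b` — the barrier class of Def. 19: a classical mean curvature flow of
  smooth closed (embedded) hypersurfaces on `[a,b]`: `F : ℝ → N → M` with `N` a compact
  `n`-manifold, jointly smooth on a neighbourhood of `[a,b] × N`, each `F t` (`t ∈ [a,b]`) an
  injective (spacelike =) immersion with a smooth unit normal `ν t`, and the equation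
  `∂F/∂t = −H ν` with `H = g.meanCurvature (F t) … (ν t)` (the tree's sign: the unit sphere of `ℝⁿ⁺¹`
  with the outward normal has `H = +n`, so spheres shrink — the mean curvature VECTOR `−Hν` does
  not depend on the choice of `ν`).
* `IsWeakSetFlowIn g W I K` — Def. 19 verbatim for `K : ℝ → Set M` (values outside `I` are
  irrelevant): `K t ⊆ W` on `I`, the spacetime track `{(x,t) : t ∈ I, x ∈ K t}` is relatively closed
  in `W ×ˢ I`, and avoidance of every classical flow of closed hypersurfaces inside `W`.
* `levelSetFlow g K₀ t` — `F_t(K₀)`, DEFINED as the union at time `t ≥ 0` of all weak set flows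
  `K` in `W = M` on `I = [0,∞)` with `K 0 ⊆ K₀` (`∅` for `t < 0`). By the printed characterisation
  this is the level set flow (the maximal such family); maximality (`subset_levelSetFlow`) and
  `F_0(K₀) = K₀` for closed `K₀` (`levelSetFlow_zero`, via the "instantly vanishing" weak set
  flow) are PROVED here; that `t ↦ F_t(K₀)` is itself a weak set flow (existence of the biggest
  flow; Ilmanen 1993, White 1995) is a theorem NOT proved here.
* `arrivalTime g K₀ x = sup {t : x ∈ F_t(K₀)} ∈ [0,∞]` (`ℝ≥0∞`; `0` if `x` is in no `F_t`, in
  particular outside `K₀` for a shrinking flow), `extinctionTime g K₀ = sup_{x ∈ K₀} u(x)`,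
  `meanConvexLevelSetFlow g K₀ t = {x ∈ K₀ | u(x) ≥ t}` — the ARRIVAL-TIME FORMULATION `K_t = {u ≥ t}`
  requested (equal to `F_t(K₀)` for compact mean-convex `K₀` by White 2000, Thm. 3.1; in general it
  contains `F_t(K₀) ∩ K₀`, `levelSetFlow_inter_subset_meanConvexLevelSetFlow`, proved),
  `limitSet g K₀ = ⋂_{t ≥ 0} K_t` (White's `K_∞`; `= {u = ∞} ∩ K₀`, proved) and
  `arrivalTimeCriticalSet g K₀` (`{∇u = 0}` in the interior of `K₀`, read through `ENNReal.toReal`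
  and `mfderiv`; by Colding–Minicozzi `u` is twice differentiable on mean-convex domains of `ℝⁿ⁺¹`,
  so no junk arises there).

PROVED API: restriction of classical flows to subintervals, the empty and the instantly-vanishing
weak set flows, `levelSetFlow_of_neg`, `subset_levelSetFlow` (maximality), `levelSetFlow_zero`,
`levelSetFlow_mono`, `le_arrivalTime`, `meanConvexLevelSetFlow_zero`, antitonicity in `t`,
emptiness past the extinction time, `mem_limitSet_iff`.

## The analytic (viscosity) formulation (Evans–Spruck 1991, §7.3; Colding–Minicozzi 2016, §4)

Appended 2026-08-15 (definition item `defn-MeanConvexLevelSetFlow`, second pass): the request asks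
for `u` as "the (viscosity) solution of the degenerate elliptic level-set equation
`|∇u| div(∇u/|∇u|) = -1`". Printed source (held text `paper:doi-10-4310-jdg-1214446559`,
pp. 668–671): for `Γ₀ = ∂U` a smooth connected hypersurface bounding the bounded open
`U ⊆ ℝⁿ` with positive mean curvature w.r.t. the inner normal (7.14), Evans–Spruck solve the level
set equation by separation of variables, `u(x,t) = v(x) - t` (7.15), where `v` is "the (unique) weak
solution of the stationary problem (7.16) `-(δ_ij - v_{x_i} v_{x_j}/|Dv|²) v_{x_i x_j} = 1` in `U`,
(7.17) `v = 0` on `∂U = Γ₀`", and "define `v ∈ C(Ū)` to be a weak solution to (7.16) provided that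
if `v - φ` has a local maximum (minimum) at a point `x₀ ∈ U` for each `φ ∈ C^∞(ℝⁿ)`, then
(7.19) `-(δ_ij - φ_{x_i} φ_{x_j}/|Dφ|²) φ_{x_i x_j} ≤ (≥) 1` at `x₀` if `Dφ(x₀) ≠ 0` and
(7.20) `-(δ_ij - η_i η_j) φ_{x_i x_j} ≤ (≥) 1` at `x₀` for some `η ∈ ℝⁿ` with `|η| ≤ 1`, if
`Dφ(x₀) = 0`"; Thm. 7.4: "There exists a unique weak solution `v` of (7.16), (7.17)" (with
`a dist(x, Γ₀) ≤ v(x) ≤ A dist(x, Γ₀)`, (7.21)); Thm. 7.5: "Let `{Γ_t}_{t ≥ 0}` denote the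
generalized evolution by mean curvature starting with `Γ₀`. Then `Γ_t = {x ∈ U | v(x) = t}` for
each `t > 0`" — so (7.18) `Γ_t ⊆ U` and `Γ_t = ∅` for `t > t* = ‖v‖_{L^∞(U)}`. Colding–Minicozzi
(§2.1 (2.3) and §4, held text `paper:arxiv-1501.07899` pp. 5, 8) write the same operator as the
`1`-Laplacian `Δ₁ u = Δu - Hess_u(∇u/|∇u|, ∇u/|∇u|) = |∇u| div(∇u/|∇u|) = -1` and restate the
definition: "`u` is a viscosity solution if it is both a sub and super solution. A continuous
function `u` is a sub solution (super solutions are defined similarly) provided that: if `φ` is a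
smooth function so that `u - φ` has a local maximum at `x₀`, then `Δ₁φ ≥ -1` at `x₀` if
`∇φ(x₀) ≠ 0`; `Δφ - Hess_φ(v, v) ≥ -1` at `x₀` for some vector `|v| ≤ 1` if `∇φ(x₀) = 0`."

Lean rendering (real definitions over the SAME `g`; the printed `D`, `D²`, `Δ` of `ℝⁿ⁺¹` are read
as `∇_g = ♯ ∘ d` (`metricGradient`, `♯(mvfderiv φ)`), `Hess_g` (`PseudoRiemannianMetric.hessian`)
and `Δ_g = tr_g Hess_g` (`PseudoRiemannianMetric.dalembertian`, the Laplace–Beltrami operator of a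
Riemannian `g`) — the transcription by which the level set flow is run on Riemannian manifolds
(Ilmanen, Indiana Univ. Math. J. 41 (1992)); for `M = ℝⁿ⁺¹` with the flat metric they are the
printed formulas):

* `levelSetOperator g φ x = Δ_g φ(x) - Hess_g φ_x(∇φ, ∇φ)/g_x(∇φ, ∇φ)` — `Δ₁φ(x)` (junk `Δ_g φ(x)`
  where `∇φ(x) = 0`, a case the definitions below treat separately, as printed);
* `IsArrivalTimeSubsolutionOn g U u` / `IsArrivalTimeSupersolutionOn g U u` — (7.19)–(7.20) with
  `≤` (local maxima of `u - φ`) resp. `≥` (local minima), test functions `φ ∈ C^∞(M)`, points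
  `x₀ ∈ U`; `IsArrivalTimeSolutionOn` — both ("weak solution", i.e. viscosity solution, in `U`);
* `MeanConvexLevelSetFlow g K₀ u` — THE REQUESTED NOTION in its analytic form: `u : M → ℝ` is an
  arrival time for the compact domain `K₀` in the sense of Evans–Spruck's Dirichlet problem
  (7.16)–(7.17): continuous on `K₀`, `= 0` on `frontier K₀`, and a weak solution in `interior K₀`;
  the flow it generates is `superlevelFlow K₀ u t = {x ∈ K₀ | u x ≥ t}` (7.18), extinct after
  `sSup (u '' K₀)` (proved: `MeanConvexLevelSetFlow.superlevelFlow_eq_empty`). By Thms. 7.4–7.5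
  (`ℝⁿ⁺¹`, `∂K₀` smooth strictly mean-convex) such a `u` exists, is unique, and its flow is the
  level set flow `levelSetFlow g K₀`, so that `u` agrees with White's `arrivalTime g K₀` (read in `ℝ`) —
  theorems NOT proved or asserted here. In a general Riemannian manifold White's flow of `K₀`
  need not go extinct (`limitSet`, on which `arrivalTime = ∞`); the analytic structure describes
  the extinct case `T(K₀) = sup u < ∞` of the request, the geometric definitions above the
  general one.

## Not here (statement hooks only)

White's theorems (2000, Thm. 3.1: nestedness and `K_t = {u ≥ t}`; long-time behaviour
`K_t → K_∞` with `∂K_∞` a stable minimal hypersurface for `n < 7`; 2003/2012: convex-type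
blow-ups, homotopy type of the complement) and Colding–Minicozzi's regularity are to be vendored
as named facts over THIS vocabulary by cite items; none is asserted in this file (D-0026).
The primary source White 2000 is paywalled here (`acq-02306`); Def. 19 of Hershkovits–White is
White's own restatement of the definition he uses.

## References

* [White2000] B. White, *The size of the singular set in mean curvature flow of mean-convex
  sets*, J. Amer. Math. Soc. 13 (2000), 665–695, §§2–3 (weak set flows, level set flow, Thm. 3.1).
* [HershkovitsWhite2019] O. Hershkovits, B. White, *Nonfattening of mean curvature flow at
  singularities of mean convex type*, Comm. Pure Appl. Math. 73 (2020), 558–580, Appendix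
  (Def. 19, Thm. 20, the paragraph following it, Prop. 21) and §1 (p. 3); arXiv:1704.00431.
* [ColdingMinicozzi2016] T. H. Colding, W. P. Minicozzi II, *Differentiability of the arrival
  time*, Comm. Pure Appl. Math. 69 (2016), 2349–2363, §1 (arrival time), §1.1, §4 (viscosity
  formulation); arXiv:1501.07899.
* [White2002], [White2012] B. White, J. Amer. Math. Soc. 16 (2003); Invent. Math. 191 (2013).
* [EvansSpruck1991] L. C. Evans, J. Spruck, *Motion of level sets by mean curvature. I*,
  J. Differential Geom. 33 (1991), 635–681, §7.3 (pp. 668–671: (7.14)–(7.21), Thms. 7.4, 7.5).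
-/

noncomputable section

open Bundle Set Manifold Filter
open scoped ContDiff Topology Manifold ENNReal

namespace Literature.Geometry.Riemannian

open Literature.Geometry.Lorentzian
open Literature.Geometry.Lorentzian.PseudoRiemannianMetric

universe u

variable {n : ℕ} {M : Type u} [TopologicalSpace M] [ChartedSpace (EuclideanSpace ℝ (Fin (n + 1))) M]
  [IsManifold (𝓡 (n + 1)) ∞ M]
  (g : PseudoRiemannianMetric (𝓡 (n + 1)) ∞ (EuclideanSpace ℝ (Fin (n + 1)))
    (TangentSpace (𝓡 (n + 1)) : M → Type _))
  [g.HasLeviCivita]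

/-! ### Classical mean curvature flows of closed hypersurfaces (the barriers) -/

section Classical

variable {N : Type*} [TopologicalSpace N] [ChartedSpace (EuclideanSpace ℝ (Fin n)) N]
  [IsManifold (𝓡 n) ∞ N]

/-- A **classical mean curvature flow of smooth closed hypersurfaces on `[a, b]`** in `(M, g)`
(the comparison flows of Hershkovits–White, Def. 19; White 2000, §2): a one-parameter family of
maps `F t : N → M` of the compact `n`-manifold `N` with fields `ν t` along `F t`, such that
`(t, y) ↦ F t y` is smooth on a neighbourhood of `[a, b] × N`, and for every `t ∈ [a, b]`: `F t`
is an injective immersion (`IsSpacelikeImmersion`, i.e. an immersion, the ambient metric being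
meant Riemannian — so `S(t) = range (F t)` is a smooth closed embedded hypersurface), `ν t` is a
unit normal along `F t` (`g(ν, ν) = 1`), smooth into `TM`, and the flow equation
`∂F/∂t (t, y) = −H(t, y) · ν t y` holds, `H = g.meanCurvature (F t) _ _ (ν t)` (the tree's sign
convention, `Hypersurface.lean`: round spheres with the outward normal have `H > 0` and shrink;
`−H ν` is the mean curvature vector, independent of the choice of `ν`).
[cite: HershkovitsWhite2019, Appendix Def. 19] [cite: White2000, §2] -/
structure IsClassicalMCF (F : ℝ → N → M) (ν : (t : ℝ) → NormalField (𝓡 (n + 1)) (F t))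
    (a b : ℝ) : Prop where
  /-- `N` is compact (the hypersurfaces are closed). -/
  compactSpace : CompactSpace N
  /-- The family is jointly smooth on `U × N` for some open `U ⊇ [a, b]`. -/
  contMDiffOn : ∃ U : Set ℝ, IsOpen U ∧ Set.Icc a b ⊆ U ∧
    ContMDiffOn (𝓘(ℝ, ℝ).prod (𝓡 n)) (𝓡 (n + 1)) ∞ (fun p : ℝ × N ↦ F p.1 p.2) (U ×ˢ univ)
  /-- Each `F t`, `t ∈ [a, b]`, is an immersion. -/
  isSpacelikeImmersion : ∀ t ∈ Set.Icc a b, g.IsSpacelikeImmersion (𝓡 n) (F t)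
  /-- Each `F t`, `t ∈ [a, b]`, is injective (embedded hypersurfaces). -/
  injective : ∀ t ∈ Set.Icc a b, Function.Injective (F t)
  /-- Each `ν t` is a unit normal along `F t`. -/
  isUnitNormal : ∀ t ∈ Set.Icc a b, g.IsUnitNormal (𝓡 n) (F t) (ν t) 1
  /-- Each `ν t` is smooth as a map into the tangent bundle. -/
  contMDiff_normal : ∀ t ∈ Set.Icc a b, ContMDiff (𝓡 n) (𝓡 (n + 1)).tangent ∞
    fun y ↦ (TotalSpace.mk' (EuclideanSpace ℝ (Fin (n + 1))) (F t y) (ν t y) :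
      TangentBundle (𝓡 (n + 1)) M)
  /-- The flow equation `∂F/∂t = −H ν` on `[a, b]`. -/
  velocity_eq : ∀ t (ht : t ∈ Set.Icc a b) (y : N),
    mfderiv 𝓘(ℝ, ℝ) (𝓡 (n + 1)) (fun s ↦ F s y) t (1 : ℝ) =
      -(g.meanCurvature (F t) contMDiff_pullbackBilin_holds (isSpacelikeImmersion t ht) (ν t) y) •
        ν t y

variable {g}

/-- A classical flow on `[a, b]` restricts to a classical flow on every subinterval
`[a', b'] ⊆ [a, b]`. [folklore] -/
theorem IsClassicalMCF.mono {F : ℝ → N → M} {ν : (t : ℝ) → NormalField (𝓡 (n + 1)) (F t)}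
    {a b a' b' : ℝ} (h : IsClassicalMCF g F ν a b) (hsub : Set.Icc a' b' ⊆ Set.Icc a b) :
    IsClassicalMCF g F ν a' b' where
  compactSpace := h.compactSpace
  contMDiffOn := by
    obtain ⟨U, hU, hIU, hF⟩ := h.contMDiffOn
    exact ⟨U, hU, hsub.trans hIU, hF⟩
  isSpacelikeImmersion t ht := h.isSpacelikeImmersion t (hsub ht)
  injective t ht := h.injective t (hsub ht)
  isUnitNormal t ht := h.isUnitNormal t (hsub ht)
  contMDiff_normal t ht := h.contMDiff_normal t (hsub ht)
  velocity_eq t ht y := h.velocity_eq t (hsub ht) y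

/-- The time-`t` hypersurface `S(t) = range (F t)` of a classical flow is compact.
[folklore] -/
theorem IsClassicalMCF.isCompact_range [T2Space M] {F : ℝ → N → M}
    {ν : (t : ℝ) → NormalField (𝓡 (n + 1)) (F t)} {a b : ℝ} (h : IsClassicalMCF g F ν a b)
    {t : ℝ} (ht : t ∈ Set.Icc a b) : IsCompact (Set.range (F t)) := by
  haveI := h.compactSpace
  exact _root_.isCompact_range (h.isSpacelikeImmersion t ht).contMDiff_self.continuous

end Classical

/-! ### Weak set flows (Hershkovits–White, Def. 19) -/

section Weak

/-- **Weak set flow in `W` on the time interval `I`** (Hershkovits–White 2020, Appendix, Def. 19;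
the notion of White 2000, §2): a family `t ↦ K t` of subsets of the open set `W ⊆ M` (only the
values for `t ∈ I` matter) such that (i) the spacetime track `{(x, t) : t ∈ I, x ∈ K t}` is a
relatively closed subset of `W × I` (it is `C ∩ (W ×ˢ I)` for a closed `C ⊆ M × ℝ`), and
(ii) **avoidance**: for every `[a, b] ⊆ I` and every classical mean curvature flow
`t ∈ [a, b] ↦ S(t) ⊆ W` of smooth closed hypersurfaces (`IsClassicalMCF`, `S(t) = range (F t)`,
over all compact `n`-manifolds `N`), if `S(a)` is disjoint from `K a` then `S(t)` is disjoint from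
`K t` for all `t ∈ [a, b]` (the parameter manifolds `N` range over the universe of `M`, so that
hypersurfaces of `M` given as subtypes qualify).
[cite: HershkovitsWhite2019, Appendix Def. 19] [cite: White2000, §2] -/
def IsWeakSetFlowIn (W : Set M) (I : Set ℝ) (K : ℝ → Set M) : Prop :=
  (∀ t ∈ I, K t ⊆ W) ∧
  (∃ C : Set (M × ℝ), IsClosed C ∧ {p : M × ℝ | p.2 ∈ I ∧ p.1 ∈ K p.2} = C ∩ W ×ˢ I) ∧
  ∀ ⦃a b : ℝ⦄, a ≤ b → Set.Icc a b ⊆ I →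
    ∀ (N : Type u) [TopologicalSpace N] [ChartedSpace (EuclideanSpace ℝ (Fin n)) N]
      [IsManifold (𝓡 n) ∞ N]
      (F : ℝ → N → M) (ν : (t : ℝ) → NormalField (𝓡 (n + 1)) (F t)),
      IsClassicalMCF g F ν a b → (∀ t ∈ Set.Icc a b, Set.range (F t) ⊆ W) →
      Disjoint (Set.range (F a)) (K a) → ∀ t ∈ Set.Icc a b, Disjoint (Set.range (F t)) (K t)

variable {g}

/-- A weak set flow in `W` stays inside `W`. [cite: HershkovitsWhite2019, Appendix Def. 19] -/
theorem IsWeakSetFlowIn.subset {W : Set M} {I : Set ℝ} {K : ℝ → Set M}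
    (h : IsWeakSetFlowIn g W I K) {t : ℝ} (ht : t ∈ I) : K t ⊆ W :=
  h.1 t ht

/-- The avoidance principle of a weak set flow.
[cite: HershkovitsWhite2019, Appendix Def. 19] -/
theorem IsWeakSetFlowIn.avoidance {W : Set M} {I : Set ℝ} {K : ℝ → Set M}
    (h : IsWeakSetFlowIn g W I K) {a b : ℝ} (hab : a ≤ b) (hI : Set.Icc a b ⊆ I)
    {N : Type u} [TopologicalSpace N] [ChartedSpace (EuclideanSpace ℝ (Fin n)) N]
    [IsManifold (𝓡 n) ∞ N] {F : ℝ → N → M} {ν : (t : ℝ) → NormalField (𝓡 (n + 1)) (F t)}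
    (hF : IsClassicalMCF g F ν a b) (hW : ∀ t ∈ Set.Icc a b, Set.range (F t) ⊆ W)
    (ha : Disjoint (Set.range (F a)) (K a)) {t : ℝ} (ht : t ∈ Set.Icc a b) :
    Disjoint (Set.range (F t)) (K t) :=
  h.2.2 hab hI N F ν hF hW ha t ht

variable (g) in
/-- The **empty flow** is a weak set flow (in any `W`, on any `I`). [folklore] -/
theorem isWeakSetFlowIn_empty (W : Set M) (I : Set ℝ) : IsWeakSetFlowIn g W I fun _ ↦ ∅ := by
  refine ⟨fun t _ ↦ Set.empty_subset _, ⟨∅, isClosed_empty, ?_⟩, ?_⟩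
  · ext p; simp
  · intro a b _ _ N _ _ _ F ν _ _ _ t _
    exact Set.disjoint_empty _

variable (g) in
/-- **The instantly vanishing flow** `K 0 = K₀`, `K t = ∅` for `t ≠ 0`, is a weak set flow in `M`
on `[0, ∞)` for every CLOSED `K₀` (its track `K₀ × {0}` is closed; avoidance is vacuous after time
`0`). Weak set flows are "subsolutions": they may disappear at will, which is why the level set flow
is defined as the BIGGEST one (Ilmanen; White). [cite: HershkovitsWhite2019, §1 (p. 3) and Appendix] -/
theorem isWeakSetFlowIn_flash {K₀ : Set M} (hK₀ : IsClosed K₀) :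
    IsWeakSetFlowIn g Set.univ (Set.Ici 0) fun t ↦ if t = 0 then K₀ else ∅ := by
  refine ⟨fun t _ ↦ Set.subset_univ _, ⟨K₀ ×ˢ {0}, hK₀.prod isClosed_singleton, ?_⟩, ?_⟩
  · ext ⟨x, t⟩
    simp only [Set.mem_setOf_eq, Set.mem_Ici, Set.mem_inter_iff, Set.mem_prod,
      Set.mem_singleton_iff, Set.mem_univ, true_and]
    constructor
    · rintro ⟨ht, hx⟩
      split_ifs at hx with h0
      · exact ⟨⟨hx, h0⟩, ht⟩
      · exact absurd hx (Set.notMem_empty x)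
    · rintro ⟨⟨hx, rfl⟩, _⟩
      simp [hx]
  · intro a b hab hI N _ _ _ F ν _ _ ha t ht
    by_cases h0 : t = 0
    · -- then `a = 0 = t`
      have ha0 : a = 0 := le_antisymm (h0 ▸ ht.1) (hI (Set.left_mem_Icc.2 hab))
      subst h0
      subst ha0
      exact ha
    · simp [h0]

end Weak

/-! ### The level set flow (biggest flow) and the arrival time -/

section LevelSet

/-- **The level set flow `F_t(K₀)` of `K₀ ⊆ M`** (White 2000, §2; Hershkovits–White 2020, after
Thm. 20: the biggest weak set flow starting inside `K₀`): for `t ≥ 0` the set of points lying at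
time `t` in SOME weak set flow `K` in `M` on `[0, ∞)` with `K 0 ⊆ K₀`; `∅` for `t < 0`. By the
printed characterisation ("the maximal family of sets satisfying the two properties", i.e. every
weak set flow from inside `K₀` lies in it — `subset_levelSetFlow` — and it is itself a weak set
flow — Ilmanen 1993 / White 1995, not proved here) this is the level set flow; it coincides with
the Evans–Spruck / Chen–Giga–Goto viscosity flow. Intended for closed `K₀` (`levelSetFlow_zero`).
[cite: HershkovitsWhite2019, Appendix (after Thm. 20)] [cite: White2000, §2] -/
def levelSetFlow (K₀ : Set M) (t : ℝ) : Set M :=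
  {x | 0 ≤ t ∧ ∃ K : ℝ → Set M, IsWeakSetFlowIn g Set.univ (Set.Ici 0) K ∧ K 0 ⊆ K₀ ∧ x ∈ K t}

variable {g}

/-- Membership in the level set flow, unfolded. [cite: HershkovitsWhite2019, Appendix] -/
theorem mem_levelSetFlow_iff {K₀ : Set M} {t : ℝ} {x : M} :
    x ∈ levelSetFlow g K₀ t ↔
      0 ≤ t ∧ ∃ K : ℝ → Set M, IsWeakSetFlowIn g Set.univ (Set.Ici 0) K ∧ K 0 ⊆ K₀ ∧ x ∈ K t :=
  Iff.rfl

/-- The level set flow lives on `[0, ∞)`: it is empty at negative times. [folklore] -/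
theorem levelSetFlow_of_neg (K₀ : Set M) {t : ℝ} (ht : t < 0) : levelSetFlow g K₀ t = ∅ :=
  Set.eq_empty_of_forall_notMem fun _ hx ↦ (not_le.2 ht) hx.1

/-- **Maximality**: every weak set flow in `M` on `[0, ∞)` that starts inside `K₀` stays inside the
level set flow of `K₀` (the defining property of `F_t`, Hershkovits–White after Thm. 20: "if
`S(0) ⊆ M` then `S(t) ⊆ F_t(M)`"). [cite: HershkovitsWhite2019, Appendix (after Thm. 20)] -/
theorem subset_levelSetFlow {K₀ : Set M} {K : ℝ → Set M}
    (hK : IsWeakSetFlowIn g Set.univ (Set.Ici 0) K) (h0 : K 0 ⊆ K₀) {t : ℝ} (ht : 0 ≤ t) :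
    K t ⊆ levelSetFlow g K₀ t :=
  fun _ hx ↦ ⟨ht, K, hK, h0, hx⟩

/-- At time `0` the level set flow is contained in `K₀`. [folklore] -/
theorem levelSetFlow_zero_subset (K₀ : Set M) : levelSetFlow g K₀ 0 ⊆ K₀ := by
  rintro x ⟨_, K, _, h0, hx⟩
  exact h0 hx

/-- **`F_0(K₀) = K₀` for closed `K₀`** ("a one-parameter family of closed sets starting at
`F_0(X) = X`", Hershkovits–White p. 3): `⊇` by the instantly vanishing weak set flow
`isWeakSetFlowIn_flash`. [cite: HershkovitsWhite2019, §1 (p. 3)] -/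
theorem levelSetFlow_zero {K₀ : Set M} (hK₀ : IsClosed K₀) : levelSetFlow g K₀ 0 = K₀ := by
  refine Set.Subset.antisymm (levelSetFlow_zero_subset K₀) fun x hx ↦ ?_
  refine subset_levelSetFlow (isWeakSetFlowIn_flash g hK₀) (by simp) le_rfl ?_
  simpa using hx

/-- The level set flow is monotone in the initial set (bigger initial sets admit more weak set
flows; White 2000, §2). [cite: White2000, §2] -/
theorem levelSetFlow_mono {K₀ K₀' : Set M} (h : K₀ ⊆ K₀') (t : ℝ) :
    levelSetFlow g K₀ t ⊆ levelSetFlow g K₀' t := by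
  rintro x ⟨ht, K, hK, h0, hx⟩
  exact ⟨ht, K, hK, h0.trans h, hx⟩

variable (g) in
/-- **The arrival time** `u(x) = sup {t ≥ 0 : x ∈ F_t(K₀)} ∈ [0, ∞]` of the level set flow of `K₀`
at `x` (Colding–Minicozzi 2016, §1: "the time when the front arrives at a point `x ∈ Ω₀`",
`u(x) = {t | x ∈ M_t}`; White 2000: for compact mean-convex `K₀` the flow is nested and
`F_t(K₀) = {u ≥ t}`). Values in `ℝ≥0∞`; the supremum over the empty set is `0` (points never
reached after time `0`, e.g. outside `K₀` when the flow shrinks), and `u = ∞` on the limit set.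
For non-nested flows this is the LAST time `x` belongs to the flow.
[cite: ColdingMinicozzi2016, §1] [cite: White2000, §3] -/
def arrivalTime (K₀ : Set M) (x : M) : ℝ≥0∞ :=
  ⨆ (t : ℝ) (_ : x ∈ levelSetFlow g K₀ t), ENNReal.ofReal t

/-- A point lying in `F_t(K₀)` has arrival time `≥ t`. [cite: ColdingMinicozzi2016, §1] -/
theorem le_arrivalTime {K₀ : Set M} {t : ℝ} {x : M} (hx : x ∈ levelSetFlow g K₀ t) :
    ENNReal.ofReal t ≤ arrivalTime g K₀ x :=
  le_iSup₂ (f := fun (s : ℝ) (_ : x ∈ levelSetFlow g K₀ s) ↦ ENNReal.ofReal s) t hx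

/-- The arrival time is bounded by any `T` beyond which `x` is never in the flow.
[cite: ColdingMinicozzi2016, §1] -/
theorem arrivalTime_le {K₀ : Set M} {x : M} {T : ℝ≥0∞}
    (h : ∀ t, x ∈ levelSetFlow g K₀ t → ENNReal.ofReal t ≤ T) : arrivalTime g K₀ x ≤ T :=
  iSup₂_le h

variable (g) in
/-- **The extinction time** `T(K₀) = sup_{x ∈ K₀} u(x) ∈ [0, ∞]` of (the level set flow of) `K₀`:
finite iff the arrival time is bounded on `K₀`; for a compact mean-convex `K₀` whose flow becomes
empty in finite time this is the time it disappears (White 2000, §3, "`K_t = ∅` for large `t`" in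
the extinct case). [cite: White2000, §3] -/
def extinctionTime (K₀ : Set M) : ℝ≥0∞ :=
  ⨆ x ∈ K₀, arrivalTime g K₀ x

/-- `u(x) ≤ T(K₀)` for `x ∈ K₀`. [folklore] -/
theorem arrivalTime_le_extinctionTime {K₀ : Set M} {x : M} (hx : x ∈ K₀) :
    arrivalTime g K₀ x ≤ extinctionTime g K₀ :=
  le_iSup₂ (f := fun (y : M) (_ : y ∈ K₀) ↦ arrivalTime g K₀ y) x hx

end LevelSet

/-! ### The arrival-time formulation of the flow of a (mean-convex) domain -/

section MeanConvex

variable {g}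

variable (g) in
/-- **The mean-convex level set flow in the arrival-time formulation**: `K_t = {x ∈ K₀ | u(x) ≥ t}`,
the superlevel sets of the arrival time `u = arrivalTime g K₀` (Colding–Minicozzi 2016, §1:
`Ω_t = ∪_{s ≥ t} M_s`, `u(x) = {t | x ∈ M_t}`; White 2000, Thm. 3.1: for a compact mean-convex `K₀`
with smooth boundary the level set flow is nested and equals `{u ≥ t}`). For such `K₀` this IS
White's level set flow `levelSetFlow g K₀ t` (a theorem, not proved here); in general it contains
`levelSetFlow g K₀ t ∩ K₀` (`levelSetFlow_inter_subset_meanConvexLevelSetFlow`). `K_0 = K₀`,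
`t ↦ K_t` is nonincreasing, and `K_t = ∅` once `t` exceeds the extinction time (all proved).
[cite: White2000, Thm. 3.1] [cite: ColdingMinicozzi2016, §1] -/
def meanConvexLevelSetFlow (K₀ : Set M) (t : ℝ) : Set M :=
  {x | x ∈ K₀ ∧ ENNReal.ofReal t ≤ arrivalTime g K₀ x}

/-- Membership in `K_t`, unfolded. [cite: ColdingMinicozzi2016, §1] -/
theorem mem_meanConvexLevelSetFlow_iff {K₀ : Set M} {t : ℝ} {x : M} :
    x ∈ meanConvexLevelSetFlow g K₀ t ↔ x ∈ K₀ ∧ ENNReal.ofReal t ≤ arrivalTime g K₀ x :=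
  Iff.rfl

/-- `K_t ⊆ K₀`: in the arrival-time formulation the flow sweeps out the initial domain
(Colding–Minicozzi: "moves monotonically inward as it sweeps out `Ω₀`"). [cite: ColdingMinicozzi2016, §1] -/
theorem meanConvexLevelSetFlow_subset (K₀ : Set M) (t : ℝ) : meanConvexLevelSetFlow g K₀ t ⊆ K₀ :=
  fun _ hx ↦ hx.1

/-- **`K_0 = K₀`** (and `K_t = K₀` for `t ≤ 0`). [cite: White2000, §3] -/
theorem meanConvexLevelSetFlow_of_nonpos (K₀ : Set M) {t : ℝ} (ht : t ≤ 0) :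
    meanConvexLevelSetFlow g K₀ t = K₀ := by
  ext x
  simp only [mem_meanConvexLevelSetFlow_iff, ENNReal.ofReal_of_nonpos ht, zero_le, and_true]

/-- `K_0 = K₀`. [cite: White2000, §3] -/
theorem meanConvexLevelSetFlow_zero (K₀ : Set M) : meanConvexLevelSetFlow g K₀ 0 = K₀ :=
  meanConvexLevelSetFlow_of_nonpos K₀ le_rfl

/-- **The flow is nested**: `s ≤ t → K_t ⊆ K_s` (White 2000, Thm. 3.1, built into the arrival-time
formulation). [cite: White2000, Thm. 3.1] -/
theorem meanConvexLevelSetFlow_antitone (K₀ : Set M) : Antitone (meanConvexLevelSetFlow g K₀) :=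
  fun _ _ hst _ hx ↦ ⟨hx.1, (ENNReal.ofReal_le_ofReal hst).trans hx.2⟩

/-- **`F_t(K₀) ∩ K₀ ⊆ K_t`**: a point of `K₀` lying in White's level set flow at time `t` has arrival
time `≥ t`. (For compact mean-convex `K₀` the two flows coincide, White 2000, Thm. 3.1.)
[cite: White2000, Thm. 3.1] -/
theorem levelSetFlow_inter_subset_meanConvexLevelSetFlow (K₀ : Set M) (t : ℝ) :
    levelSetFlow g K₀ t ∩ K₀ ⊆ meanConvexLevelSetFlow g K₀ t :=
  fun _ hx ↦ ⟨hx.2, le_arrivalTime hx.1⟩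

/-- **Extinction**: if the extinction time is `< t`, then `K_t = ∅`. [cite: White2000, §3] -/
theorem meanConvexLevelSetFlow_eq_empty {K₀ : Set M} {t : ℝ}
    (ht : extinctionTime g K₀ < ENNReal.ofReal t) : meanConvexLevelSetFlow g K₀ t = ∅ := by
  refine Set.eq_empty_of_forall_notMem fun x hx ↦ ?_
  have h1 : arrivalTime g K₀ x ≤ extinctionTime g K₀ :=
    le_iSup₂ (f := fun (y : M) (_ : y ∈ K₀) ↦ arrivalTime g K₀ y) x hx.1
  exact (lt_irrefl _) ((hx.2.trans h1).trans_lt ht)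

/-- Conversely, if some `K_t`, `t ≥ 0`, is empty then the extinction time is `≤ t`.
[cite: White2000, §3] -/
theorem extinctionTime_le_of_eq_empty {K₀ : Set M} {t : ℝ}
    (h : meanConvexLevelSetFlow g K₀ t = ∅) : extinctionTime g K₀ ≤ ENNReal.ofReal t := by
  refine iSup₂_le fun x hx ↦ ?_
  by_contra hlt
  have hmem : x ∈ meanConvexLevelSetFlow g K₀ t := ⟨hx, (not_le.1 hlt).le⟩
  rw [h] at hmem
  exact hmem

variable (g) in
/-- **The limit set `K_∞ = ⋂_{t ≥ 0} K_t`** of the flow of `K₀` (White 2000: for a compact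
mean-convex `K₀`, `K_t → K_∞` and, when `K_∞ ≠ ∅` and `n < 7`, `∂K_∞` is a stable minimal
hypersurface; `K_∞ = ∅` iff the flow goes extinct). [cite: White2000, §1 and §3] -/
def limitSet (K₀ : Set M) : Set M :=
  ⋂ (t : ℝ) (_ : 0 ≤ t), meanConvexLevelSetFlow g K₀ t

/-- `K_∞ = {x ∈ K₀ | u(x) = ∞}`: a point survives for all times iff its arrival time is infinite.
[cite: White2000, §3] -/
theorem mem_limitSet_iff {K₀ : Set M} {x : M} :
    x ∈ limitSet g K₀ ↔ x ∈ K₀ ∧ arrivalTime g K₀ x = ⊤ := by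
  simp only [limitSet, Set.mem_iInter, mem_meanConvexLevelSetFlow_iff]
  constructor
  · intro h
    refine ⟨(h 0 le_rfl).1, ?_⟩
    refine ENNReal.eq_top_of_forall_nnreal_le fun r ↦ ?_
    have := (h r r.2).2
    simpa only [ENNReal.ofReal_coe_nnreal] using this
  · rintro ⟨hx, htop⟩ t _
    exact ⟨hx, htop ▸ le_top⟩

/-- The limit set lies in every `K_t`. [cite: White2000, §3] -/
theorem limitSet_subset {K₀ : Set M} {t : ℝ} (ht : 0 ≤ t) :
    limitSet g K₀ ⊆ meanConvexLevelSetFlow g K₀ t :=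
  Set.biInter_subset_of_mem ht

/-- A finite extinction time forces an empty limit set. [cite: White2000, §3] -/
theorem limitSet_eq_empty_of_extinctionTime_lt_top {K₀ : Set M}
    (h : extinctionTime g K₀ < ⊤) : limitSet g K₀ = ∅ := by
  refine Set.eq_empty_of_forall_notMem fun x hx ↦ ?_
  rw [mem_limitSet_iff] at hx
  have h1 : arrivalTime g K₀ x ≤ extinctionTime g K₀ :=
    le_iSup₂ (f := fun (y : M) (_ : y ∈ K₀) ↦ arrivalTime g K₀ y) x hx.1
  rw [hx.2, top_le_iff] at h1
  exact (lt_irrefl _) (h1 ▸ h)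

variable (g) in
/-- **The critical (singular) set `{∇u = 0}` of the arrival time** in the interior of `K₀`
(Colding–Minicozzi 2016, Thm. 1: on a mean-convex domain of `ℝⁿ⁺¹`, `u` is twice differentiable
everywhere, smooth with `∇u ≠ 0` exactly on the regular set of the flow, and at each critical point
`Hess u` has eigenvalues `0` and `−1/k`; the critical set is where the flow is singular). Read
through `ENNReal.toReal` (junk where `u = ∞`, i.e. on the limit set) and `mfderiv` (junk value `0`
where `u` is not differentiable — no such points in the Colding–Minicozzi setting).
[cite: ColdingMinicozzi2016, Thm. 1] -/
def arrivalTimeCriticalSet (K₀ : Set M) : Set M :=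
  {x | x ∈ interior K₀ ∧
    mfderiv (𝓡 (n + 1)) 𝓘(ℝ, ℝ) (fun y ↦ (arrivalTime g K₀ y).toReal) x = 0}

/-- The critical set lies in the interior of `K₀`. [cite: ColdingMinicozzi2016, Thm. 1] -/
theorem arrivalTimeCriticalSet_subset_interior (K₀ : Set M) :
    arrivalTimeCriticalSet g K₀ ⊆ interior K₀ :=
  fun _ hx ↦ hx.1

end MeanConvex

/-! ### The analytic (viscosity) formulation of the arrival time (Evans–Spruck §7.3) -/

section Viscosity

variable {g}

variable (g) in
/-- The **`g`-gradient** `∇φ(x) = (dφ_x)^♯ ∈ T_x M` of a real function: the image of the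
differential `dφ_x = mvfderiv φ x : T_x M →L[ℝ] ℝ` under the musical isomorphism `sharp` of `g`
(junk `0` where `φ` is not differentiable, as `mfderiv`); the idiom `♯(mvfderiv F)` of
`GradientSection.lean`. O'Neill 1983, Ch. 3, Def. 3.47 (`grad f`, `g(grad f, X) = df(X)` —
`val_metricGradient`). [folklore] -/
def metricGradient (φ : M → ℝ) (x : M) : TangentSpace (𝓡 (n + 1)) x :=
  g.sharp x (mvfderiv (𝓡 (n + 1)) φ x)

omit [IsManifold (𝓡 (n + 1)) ∞ M] [g.HasLeviCivita] in
/-- `mvfderiv φ x` (values in `ℝ`) and `mfderiv φ x` (values in `T_{φ x} ℝ = ℝ`) are the same map,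
so they vanish together. [folklore] -/
theorem mvfderiv_eq_zero_iff_mfderiv {φ : M → ℝ} {x : M} :
    mvfderiv (𝓡 (n + 1)) φ x = 0 ↔ mfderiv (𝓡 (n + 1)) 𝓘(ℝ, ℝ) φ x = 0 := by
  simp only [ContinuousLinearMap.ext_iff]
  exact Iff.rfl

omit [g.HasLeviCivita] in
/-- Defining property of the gradient: `g_x(∇φ(x), v) = dφ_x(v)`. O'Neill 1983, Ch. 3, Def. 3.47.
[folklore] -/
@[simp]
theorem val_metricGradient (φ : M → ℝ) (x : M) (v : TangentSpace (𝓡 (n + 1)) x) :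
    g.val x (metricGradient g φ x) v = mfderiv (𝓡 (n + 1)) 𝓘(ℝ, ℝ) φ x v := by
  rw [metricGradient, val_sharp_apply]
  rfl

omit [g.HasLeviCivita] in
/-- `∇φ(x) = 0 ↔ dφ_x = 0` (`♯` is a linear isomorphism). [folklore] -/
theorem metricGradient_eq_zero_iff {φ : M → ℝ} {x : M} :
    metricGradient g φ x = 0 ↔ mfderiv (𝓡 (n + 1)) 𝓘(ℝ, ℝ) φ x = 0 := by
  rw [metricGradient, LinearEquiv.map_eq_zero_iff,
    ContinuousLinearMap.coe_injective.eq_iff' (ContinuousLinearMap.toLinearMap_zero ..)]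
  exact mvfderiv_eq_zero_iff_mfderiv

omit [g.HasLeviCivita] in
/-- The gradient of a constant vanishes. [folklore] -/
@[simp]
theorem metricGradient_const (c : ℝ) (x : M) : metricGradient g (fun _ ↦ c) x = 0 := by
  rw [metricGradient_eq_zero_iff]
  exact mfderiv_const

variable (g) in
/-- The **level set operator** `Δ₁φ(x) = Δ_g φ(x) - Hess_g φ_x(∇φ, ∇φ) / g_x(∇φ, ∇φ)`
(`= |∇φ| div(∇φ/|∇φ|)`, the trace of the Hessian over `∇φ^⊥`; Colding–Minicozzi's `1`-Laplacian,
(2.3); minus the left-hand side `-(δ_ij - φ_{x_i}φ_{x_j}/|Dφ|²)φ_{x_i x_j}` of Evans–Spruck's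
(7.16)), with `Δ_g = PseudoRiemannianMetric.dalembertian` (`tr_g Hess`) and
`Hess_g = PseudoRiemannianMetric.hessian`. Meaningful where `∇φ(x) ≠ 0` (at critical points the
value is the junk `Δ_g φ(x)`, since `r / 0 = 0`; the viscosity conditions below treat that case
separately, as printed). The arrival time solves `Δ₁u = -1`.
[cite: ColdingMinicozzi2016, §2.1 (2.3)] [cite: EvansSpruck1991, §7.3 (7.16)] -/
def levelSetOperator (φ : M → ℝ) (x : M) : ℝ :=
  g.dalembertian φ x -
    g.hessian φ x (metricGradient g φ x) (metricGradient g φ x) /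
      g.val x (metricGradient g φ x) (metricGradient g φ x)

variable (g) in
/-- **Viscosity subsolution of `Δ₁u = -1` in the open set `U`** (Evans–Spruck (7.19)–(7.20), the
"`≤`" half, in Colding–Minicozzi's sign: for every smooth `φ : M → ℝ` and every `x₀ ∈ U` at which
`u - φ` has a local maximum, `Δ₁φ(x₀) ≥ -1` if `dφ(x₀) ≠ 0`, and
`Δ_g φ(x₀) - Hess_g φ_{x₀}(η, η) ≥ -1` for SOME `η ∈ T_{x₀}M` with `g(η, η) ≤ 1` if `dφ(x₀) = 0`.
(Continuity of `u` is required separately, as printed: `v ∈ C(Ū)`.)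
[cite: EvansSpruck1991, §7.3 (7.19)–(7.20)] [cite: ColdingMinicozzi2016, §4] -/
def IsArrivalTimeSubsolutionOn (U : Set M) (u : M → ℝ) : Prop :=
  ∀ ⦃φ : M → ℝ⦄, ContMDiff (𝓡 (n + 1)) 𝓘(ℝ, ℝ) ∞ φ → ∀ ⦃x₀ : M⦄, x₀ ∈ U →
    IsLocalMax (fun x ↦ u x - φ x) x₀ →
      (mfderiv (𝓡 (n + 1)) 𝓘(ℝ, ℝ) φ x₀ ≠ 0 → -1 ≤ levelSetOperator g φ x₀) ∧
      (mfderiv (𝓡 (n + 1)) 𝓘(ℝ, ℝ) φ x₀ = 0 →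
        ∃ η : TangentSpace (𝓡 (n + 1)) x₀, g.val x₀ η η ≤ 1 ∧
          -1 ≤ g.dalembertian φ x₀ - g.hessian φ x₀ η η)

variable (g) in
/-- **Viscosity supersolution of `Δ₁u = -1` in the open set `U`** (Evans–Spruck (7.19)–(7.20), the
"`≥`" half: local MINIMA of `u - φ`, `Δ₁φ(x₀) ≤ -1` if `dφ(x₀) ≠ 0`, and
`Δ_g φ(x₀) - Hess_g φ_{x₀}(η, η) ≤ -1` for some `η` with `g(η, η) ≤ 1` if `dφ(x₀) = 0`).
[cite: EvansSpruck1991, §7.3 (7.19)–(7.20)] [cite: ColdingMinicozzi2016, §4] -/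
def IsArrivalTimeSupersolutionOn (U : Set M) (u : M → ℝ) : Prop :=
  ∀ ⦃φ : M → ℝ⦄, ContMDiff (𝓡 (n + 1)) 𝓘(ℝ, ℝ) ∞ φ → ∀ ⦃x₀ : M⦄, x₀ ∈ U →
    IsLocalMin (fun x ↦ u x - φ x) x₀ →
      (mfderiv (𝓡 (n + 1)) 𝓘(ℝ, ℝ) φ x₀ ≠ 0 → levelSetOperator g φ x₀ ≤ -1) ∧
      (mfderiv (𝓡 (n + 1)) 𝓘(ℝ, ℝ) φ x₀ = 0 →
        ∃ η : TangentSpace (𝓡 (n + 1)) x₀, g.val x₀ η η ≤ 1 ∧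
          g.dalembertian φ x₀ - g.hessian φ x₀ η η ≤ -1)

variable (g) in
/-- **Viscosity ("weak") solution of `Δ₁u = -1` in `U`**: a sub- and a supersolution
(Evans–Spruck (7.19)–(7.20); Colding–Minicozzi §4: "`u` is a viscosity solution if it is both a sub
and super solution").
[cite: EvansSpruck1991, §7.3 (7.19)–(7.20)] [cite: ColdingMinicozzi2016, §4] -/
def IsArrivalTimeSolutionOn (U : Set M) (u : M → ℝ) : Prop :=
  IsArrivalTimeSubsolutionOn g U u ∧ IsArrivalTimeSupersolutionOn g U u

/-- Subsolutions restrict to smaller open sets. [folklore] -/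
theorem IsArrivalTimeSubsolutionOn.mono {U U' : Set M} {u : M → ℝ}
    (h : IsArrivalTimeSubsolutionOn g U u) (hU : U' ⊆ U) : IsArrivalTimeSubsolutionOn g U' u :=
  fun _ hφ _ hx hmax ↦ h hφ (hU hx) hmax

/-- Supersolutions restrict to smaller open sets. [folklore] -/
theorem IsArrivalTimeSupersolutionOn.mono {U U' : Set M} {u : M → ℝ}
    (h : IsArrivalTimeSupersolutionOn g U u) (hU : U' ⊆ U) : IsArrivalTimeSupersolutionOn g U' u :=
  fun _ hφ _ hx hmin ↦ h hφ (hU hx) hmin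

/-- Solutions restrict to smaller open sets. [folklore] -/
theorem IsArrivalTimeSolutionOn.mono {U U' : Set M} {u : M → ℝ}
    (h : IsArrivalTimeSolutionOn g U u) (hU : U' ⊆ U) : IsArrivalTimeSolutionOn g U' u :=
  ⟨h.1.mono hU, h.2.mono hU⟩

variable (g) in
/-- Any function is a solution on the empty set (the conditions only bear on points of `U`).
[folklore] -/
theorem isArrivalTimeSolutionOn_empty (u : M → ℝ) : IsArrivalTimeSolutionOn g ∅ u :=
  ⟨fun _ _ _ hx ↦ (Set.notMem_empty _ hx).elim, fun _ _ _ hx ↦ (Set.notMem_empty _ hx).elim⟩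

/-- **The flow generated by an arrival-time function**: `K_t = {x ∈ K₀ | u(x) ≥ t}`, the compact
region bounded by Evans–Spruck's `Γ_t = {x ∈ U | v(x) = t}` (7.18) together with the not yet
reached part of `K₀` (Colding–Minicozzi §1: `Ω_t = ∪_{s ≥ t} M_s`). Compare
`meanConvexLevelSetFlow g K₀ t = {x ∈ K₀ | arrivalTime g K₀ x ≥ t}` for White's `[0, ∞]`-valued
arrival time. [cite: EvansSpruck1991, §7.3 (7.18)] [cite: ColdingMinicozzi2016, §1] -/
def superlevelFlow (K₀ : Set M) (u : M → ℝ) (t : ℝ) : Set M :=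
  {x | x ∈ K₀ ∧ t ≤ u x}

omit [TopologicalSpace M] in
/-- Membership in `K_t`, unfolded. [cite: EvansSpruck1991, §7.3 (7.18)] -/
theorem mem_superlevelFlow_iff {K₀ : Set M} {u : M → ℝ} {t : ℝ} {x : M} :
    x ∈ superlevelFlow K₀ u t ↔ x ∈ K₀ ∧ t ≤ u x :=
  Iff.rfl

omit [TopologicalSpace M] in
/-- `K_t ⊆ K₀`. [cite: EvansSpruck1991, §7.3 (7.18)] -/
theorem superlevelFlow_subset (K₀ : Set M) (u : M → ℝ) (t : ℝ) : superlevelFlow K₀ u t ⊆ K₀ :=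
  fun _ hx ↦ hx.1

omit [TopologicalSpace M] in
/-- The generated flow is nested: `s ≤ t → K_t ⊆ K_s`. [cite: ColdingMinicozzi2016, §1] -/
theorem superlevelFlow_antitone (K₀ : Set M) (u : M → ℝ) : Antitone (superlevelFlow K₀ u) :=
  fun _ _ hst _ hx ↦ ⟨hx.1, hst.trans hx.2⟩

omit [TopologicalSpace M] in
/-- If `u ≥ t` on `K₀` (e.g. `t = 0` and `u ≥ 0`, Evans–Spruck (7.21)), then `K_t = K₀`.
[cite: EvansSpruck1991, §7.3 (7.21)] -/
theorem superlevelFlow_eq_self {K₀ : Set M} {u : M → ℝ} {t : ℝ} (h : ∀ x ∈ K₀, t ≤ u x) :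
    superlevelFlow K₀ u t = K₀ :=
  Set.Subset.antisymm (superlevelFlow_subset K₀ u t) fun x hx ↦ ⟨hx, h x hx⟩

omit [TopologicalSpace M] in
/-- Past `sup_{K₀} u` the generated flow is empty ("`Γ_t = ∅` for `t > t* = ‖v‖_∞`",
Evans–Spruck after (7.18)), provided `u` is bounded above on `K₀`.
[cite: EvansSpruck1991, §7.3 (7.18)] -/
theorem superlevelFlow_eq_empty {K₀ : Set M} {u : M → ℝ} (hb : BddAbove (u '' K₀)) {t : ℝ}
    (ht : sSup (u '' K₀) < t) : superlevelFlow K₀ u t = ∅ :=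
  Set.eq_empty_of_forall_notMem fun _ hx ↦
    (lt_irrefl t) ((hx.2.trans (le_csSup hb (Set.mem_image_of_mem u hx.1))).trans_lt ht)

variable (g) in
/-- **Mean-convex level set flow in the arrival-time formulation, analytic form** (the requested
notion `MeanConvexLevelSetFlow`): `u : M → ℝ` is an ARRIVAL TIME for the (compact, mean-convex)
domain `K₀ ⊆ M`, i.e. a weak solution of Evans–Spruck's Dirichlet problem (7.16)–(7.17) —
`u ∈ C(K₀)`, `u = 0` on `∂K₀ = frontier K₀`, and `u` is a viscosity solution of
`Δ₁u = |∇u| div(∇u/|∇u|) = -1` in `interior K₀` — the flow being `K_t = superlevelFlow K₀ u t =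
{x ∈ K₀ | u x ≥ t}` (7.18) with extinction time `T(K₀) = sup_{K₀} u < ∞`
(`MeanConvexLevelSetFlow.superlevelFlow_eq_empty`) and singular set `{x ∈ interior K₀ | du_x = 0}`
(Colding–Minicozzi, Thm. 1). For `K₀ ⊆ ℝⁿ⁺¹` compact with smooth strictly mean-convex boundary such
a `u` exists and is unique (Evans–Spruck, Thm. 7.4) and `{u = t} = Γ_t`, the (viscosity) level set
flow of `∂K₀` (Thm. 7.5) — whence, granted the identification of the viscosity level set flow with
the biggest weak set flow (Ilmanen; White; Hershkovits–White p. 3), `K_t = levelSetFlow g K₀ t` and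
`u = arrivalTime g K₀` on `K₀`. On a Riemannian manifold White's level set flow (`levelSetFlow`)
of `K₀` need not go extinct (`limitSet`, where `arrivalTime = ∞`); this structure describes the
extinct flows of the request ("`T(K) := sup u < ∞` iff the flow becomes empty"). None of these
theorems is asserted here.
Values of `u` off `K₀` are irrelevant. Intended for compact `K₀` equal to the closure of its
interior. [cite: EvansSpruck1991, §7.3 (7.16)–(7.20), Thms. 7.4–7.5]
[cite: ColdingMinicozzi2016, §1 and §4] [cite: White2000, §3] -/
structure MeanConvexLevelSetFlow (K₀ : Set M) (u : M → ℝ) : Prop where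
  /-- `u ∈ C(K₀)` ("`v ∈ C(Ū)`"). -/
  continuousOn : ContinuousOn u K₀
  /-- The Dirichlet condition (7.17): `u = 0` on `∂K₀`. -/
  eq_zero_of_mem_frontier : ∀ x ∈ frontier K₀, u x = 0
  /-- `u` is a viscosity subsolution of `Δ₁u = -1` in the interior of `K₀` ((7.19)–(7.20), `≤`). -/
  subsolution : IsArrivalTimeSubsolutionOn g (interior K₀) u
  /-- `u` is a viscosity supersolution of `Δ₁u = -1` in the interior of `K₀`
  ((7.19)–(7.20), `≥`). -/
  supersolution : IsArrivalTimeSupersolutionOn g (interior K₀) u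

namespace MeanConvexLevelSetFlow

variable {K₀ : Set M} {u : M → ℝ}

/-- An arrival time is a viscosity solution in `interior K₀`. [cite: EvansSpruck1991, §7.3] -/
theorem isArrivalTimeSolutionOn (h : MeanConvexLevelSetFlow g K₀ u) :
    IsArrivalTimeSolutionOn g (interior K₀) u :=
  ⟨h.subsolution, h.supersolution⟩

/-- On a compact domain the arrival time is bounded above (it is continuous there): the
extinction time `T(K₀) = sup_{K₀} u` is finite. [cite: EvansSpruck1991, §7.3 (7.18)] -/
theorem bddAbove_image (h : MeanConvexLevelSetFlow g K₀ u) (hK : IsCompact K₀) :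
    BddAbove (u '' K₀) :=
  (hK.image_of_continuousOn h.continuousOn).bddAbove

/-- On a nonempty compact domain the extinction time `sup_{K₀} u` is attained (it is the arrival
time of a last point). [cite: EvansSpruck1991, §7.3 (7.18)] -/
theorem exists_eq_sSup (h : MeanConvexLevelSetFlow g K₀ u) (hK : IsCompact K₀)
    (hne : K₀.Nonempty) : ∃ x ∈ K₀, u x = sSup (u '' K₀) := by
  obtain ⟨x, hx, hmax⟩ := hK.exists_isMaxOn hne h.continuousOn
  refine ⟨x, hx, le_antisymm (le_csSup (h.bddAbove_image hK) (Set.mem_image_of_mem u hx)) ?_⟩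
  exact csSup_le (hne.image u) (by rintro _ ⟨y, hy, rfl⟩; exact hmax hy)

/-- **Extinction**: on a compact domain the generated flow `K_t = {x ∈ K₀ | u x ≥ t}` is empty for
every `t > sup_{K₀} u` (Evans–Spruck: "`Γ_t = ∅` for `t > t* = ‖v‖_{L^∞(U)}`").
[cite: EvansSpruck1991, §7.3 (7.18)] -/
theorem superlevelFlow_eq_empty (h : MeanConvexLevelSetFlow g K₀ u) (hK : IsCompact K₀) {t : ℝ}
    (ht : sSup (u '' K₀) < t) : superlevelFlow K₀ u t = ∅ :=
  Riemannian.superlevelFlow_eq_empty (h.bddAbove_image hK) ht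

/-- The boundary of the domain is swept at time `0`: `frontier K₀ ∩ K₀ ⊆ {u = 0}`, so no boundary
point of `K₀` survives to a positive time. [cite: EvansSpruck1991, §7.3 (7.17)] -/
theorem notMem_superlevelFlow_of_mem_frontier (h : MeanConvexLevelSetFlow g K₀ u) {x : M}
    (hx : x ∈ frontier K₀) {t : ℝ} (ht : 0 < t) : x ∉ superlevelFlow K₀ u t :=
  fun hmem ↦ (lt_irrefl t) (lt_of_le_of_lt (h.eq_zero_of_mem_frontier x hx ▸ hmem.2) ht)

end MeanConvexLevelSetFlow

end Viscosity

end Literature.Geometry.Riemannian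

end
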